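import Summits.Parity.GeneralizedHardyLittlewood.Theorems.BeyondDiagonalBeatsQuarter.OffDiagCoreLevelsTruncBox
import Summits.Parity.GeneralizedHardyLittlewood.Theorems.BeyondDiagonalBeatsQuarter.OffDiagHeartCoreTruncation
import HarnessLib

/-!
# Route `PrimeLevelFamEdge`, crux K_B (stmt-Parity-20343), line `diagonal_kernel_split` rev 4, plan Ω —
# L7d part 2, node D5a′ step 2 `OffDiagCoreLevelsTruncMono`: **block-scale MONOMIALS for the `s`-tail term — the core
# height, the tail height, the box size and the scalar level factor are powers of `2N` on the cell nest of a block**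

L7D-PLAN §3 D5a′. On the cell nest at the block top `2N` (`r < (2N)⁷`, `l, m ≤ ⌊q̂(2N)^{Δ′}⌋ ≤ 2N` for `Δ′ ≤ 2`,
`2^{i_j} ≤ (2N)⁵` for near boxes, `d_j ≥ 1`) and levels `N < q ≤ 2N`, every atom of
`OffDiagCoreLevelsTruncBox.inner_tail_le_cost` is a monomial in `2N` (crude exponents on purpose, prover-3's K2 tools
`dTerm_le`, `sizeFactor_le_four`, `natCeil_le_add_one`):

* `coreHeight_le_block` — `coreHeight ε₀ q … ≤ 12·(2N)^{15}` (`0 ≤ ε₀ ≤ 1`);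
* `dCostSnd_div_le_block` — `D₂(N; cell)/(2π) ≤ 11·(2N)^{14}`; `tailHeight_sub_one_le_block` — for `|h₁| ≤ 12(2N)^{15}`:
  `tailHeight − 1 ≤ 134·(2N)^{30}`;
* `boxSizeSnd_le_block` — `S₂(k; cell, q) ≤ 9·S_k·(2N)^{10}` (`S_k` the dyadic-bump derivative sum);
* `norm_levelFactor_le` — `‖𝟙[cell ∈ ranges q]·2q̂(2π/q)·c_l(q)c_m(q)‖ ≤ 4π`;
* **`tail_term_le_block`** — the `(cell, h₁, q)` term of `abs_coreTailS_le` is `≤ 4π·2^{k+1}·9S_k·(2N)^{10}·134(2N)^{30}·(N^{ε₀k})⁻¹`.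

Step 3 (`OffDiagCoreLevelsTruncCount`): the nest count ⇒ funded. Theorems only; standard axioms. Helper toward
`stub_offDiagBelowSlack_io`; closes nothing.
«The programme SEARCHES and TYPES; no claim about Landau–Siegel zeros, Theorems 1–2 of arXiv:2211.02515 or
a repaired Margin232 until a kernel theorem says so.»
-/

noncomputable section

open Finset Real Polynomial
open scoped Nat

namespace Summit.Parity.GeneralizedHardyLittlewood.Theorems.BeyondDiagonalBeatsQuarter.OffDiag

open Literature.NumberTheory.LFunctions Literature.NumberTheory.LFunctions.KMV2000
open Literature.NumberTheory.Sieve.FriedlanderIwaniecPrimes (fourier2)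
open Literature.Analysis.Calculus.WhitneyConvex (dyadicBumpBound dyadicBumpBound_nonneg)
open PeterssonSplit (nearBoxes two_pi_mul_qhat_sq qhat_sq_le)

/-! ### §1. The block scale -/

section Block

variable {N q : ℕ}

/-- Block facts in `ℝ`: `1 ≤ 2N`, `q ≤ 2N`, `1 ≤ q` for `1 ≤ N ≤ q ≤ 2N`. [folklore] -/
theorem block_real_facts (hN : 1 ≤ N) (hNq : N ≤ q) (hq2 : q ≤ 2 * N) :
    (1 : ℝ) ≤ 2 * (N : ℝ) ∧ (q : ℝ) ≤ 2 * (N : ℝ) ∧ (1 : ℝ) ≤ q := by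
  refine ⟨?_, ?_, ?_⟩
  · have : (1 : ℝ) ≤ N := by exact_mod_cast hN
    linarith
  · exact_mod_cast hq2
  · exact_mod_cast le_trans hN hNq

/-- Near boxes at the block top have `2^{i_j} ≤ (2N)⁵` (`2N ≥ 40`). [folklore] -/
theorem pow_le_block_of_mem_nearBoxes {P : ℕ} (hP : 40 ≤ P) {d₁ d₂ : ℕ} (hd₁ : 1 ≤ d₁) (hd₂ : 1 ≤ d₂) {i : ℕ × ℕ}
    (hi : i ∈ nearBoxes P d₁ d₂ (Real.log P ^ 4)) :
    (2 : ℝ) ^ i.1 ≤ (P : ℝ) ^ 5 ∧ (2 : ℝ) ^ i.2 ≤ (P : ℝ) ^ 5 := by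
  have hP1 : (1 : ℝ) ≤ P := by exact_mod_cast (show 1 ≤ P by omega)
  have hP0 : (0 : ℝ) < P := by linarith
  have hfar := PeterssonSplit.not_far_of_mem_nearBoxes hi
  rw [not_le] at hfar
  have hd' : (1 : ℝ) ≤ (d₁ : ℝ) * d₂ := by exact_mod_cast Nat.mul_pos hd₁ hd₂
  have h4s : 4 * qhat P ^ 2 * Real.log P ^ 4 ≤ (P : ℝ) ^ 5 := by
    have h4 : 4 * qhat P ^ 2 ≤ (P : ℝ) := by
      rw [← two_pi_mul_qhat_sq P, show (2 * π * qhat P) ^ 2 = π ^ 2 * (4 * qhat P ^ 2) by ring]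
      have hπ : (1 : ℝ) ≤ π ^ 2 := by nlinarith [Real.pi_gt_three]
      exact le_mul_of_one_le_left (by positivity) hπ
    have hL4 : Real.log P ^ 4 ≤ (P : ℝ) ^ 4 :=
      pow_le_pow_left₀ (Real.log_nonneg hP1) ((Real.log_le_sub_one_of_pos hP0).trans (by linarith)) 4
    calc 4 * qhat P ^ 2 * Real.log P ^ 4 ≤ (P : ℝ) * (P : ℝ) ^ 4 :=
          mul_le_mul h4 hL4 (by positivity) (by positivity)
      _ = (P : ℝ) ^ 5 := by ring
  have hKK : (2 : ℝ) ^ i.1 * 2 ^ i.2 ≤ (P : ℝ) ^ 5 := by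
    calc (2 : ℝ) ^ i.1 * 2 ^ i.2 = 2 ^ (i.1 + i.2) := (pow_add _ _ _).symm
      _ ≤ 2 ^ (i.1 + i.2) * ((d₁ : ℝ) * d₂) := le_mul_of_one_le_right (by positivity) hd'
      _ ≤ 4 * qhat P ^ 2 * Real.log P ^ 4 := hfar.le
      _ ≤ (P : ℝ) ^ 5 := h4s
  have hK₁1 : (1 : ℝ) ≤ (2 : ℝ) ^ i.1 := one_le_pow₀ (by norm_num)
  have hK₂1 : (1 : ℝ) ≤ (2 : ℝ) ^ i.2 := one_le_pow₀ (by norm_num)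
  exact ⟨(le_mul_of_one_le_right (by positivity) hK₂1).trans hKK, (le_mul_of_one_le_left (by positivity) hK₁1).trans hKK⟩

/-- `⌊q̂(P)^{Δ′}⌋ ≤ P` for `P ≥ 40`, `0 < Δ′ ≤ 2`. [folklore] -/
theorem floor_qhat_rpow_le_self {P : ℕ} (hP : 40 ≤ P) {Δ' : ℝ} (h0 : 0 < Δ') (h2 : Δ' ≤ 2) : ⌊qhat P ^ Δ'⌋₊ ≤ P :=
  (floor_qhat_rpow_lt (by omega) h0 h2).le

/-- **The core height is a block monomial**: for `1 ≤ N ≤ q ≤ 2N`, `2N ≥ 40`, a cell of the nest at `2N` and `0 ≤ ε₀ ≤ 1`: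
`coreHeight ε₀ q d₁ d₂ (l/d₁) (m/d₂) (r+1) i ≤ 12·(2N)^{15}`. [cite: KowalskiMichelVanderKam2000, Lemma 3.3 p. 9 — derivation] -/
theorem coreHeight_le_block (hN : 1 ≤ N) (hNq : N ≤ q) (hq2 : q ≤ 2 * N) (hP : 40 ≤ 2 * N) {Δ' : ℝ} (h0 : 0 < Δ')
    (h2 : Δ' ≤ 2) {ε₀ : ℝ} (hε₁ : ε₀ ≤ 1) {r l m d₁ d₂ : ℕ} {i : ℕ × ℕ}
    (hr : r ∈ Finset.range ((2 * N) ^ 7)) (hl : l ∈ Finset.Icc 1 ⌊qhat (2 * N) ^ Δ'⌋₊)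
    (hm : m ∈ Finset.Icc 1 ⌊qhat (2 * N) ^ Δ'⌋₊) (hd₁ : d₁ ∈ l.divisors) (hd₂ : d₂ ∈ m.divisors)
    (hi : i ∈ nearBoxes (2 * N) d₁ d₂ (Real.log (2 * N : ℕ) ^ 4)) :
    ((coreHeight ε₀ q d₁ d₂ (l / d₁) (m / d₂) (r + 1) i : ℕ) : ℝ) ≤ 12 * (2 * (N : ℝ)) ^ 15 := by
  obtain ⟨hP1, hqP, hq1⟩ := block_real_facts hN hNq hq2
  have hP1' : (1 : ℝ) ≤ ((2 * N : ℕ) : ℝ) := by push_cast; exact hP1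
  have hd₁1 := Nat.pos_of_mem_divisors hd₁
  have hd₂1 := Nat.pos_of_mem_divisors hd₂
  obtain ⟨hK₁, hK₂⟩ := pow_le_block_of_mem_nearBoxes hP hd₁1 hd₂1 hi
  have hfl : (⌊qhat (2 * N) ^ Δ'⌋₊ : ℝ) ≤ ((2 * N : ℕ) : ℝ) := by exact_mod_cast floor_qhat_rpow_le_self hP h0 h2
  have hα : (((l / d₁ : ℕ)) : ℝ) ≤ ((2 * N : ℕ) : ℝ) :=
    le_trans (by exact_mod_cast (Nat.div_le_self l d₁).trans (Finset.mem_Icc.mp hl).2) hfl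
  have hβ : (((m / d₂ : ℕ)) : ℝ) ≤ ((2 * N : ℕ) : ℝ) :=
    le_trans (by exact_mod_cast (Nat.div_le_self m d₂).trans (Finset.mem_Icc.mp hm).2) hfl
  have hαβ : ((l / d₁ : ℕ) : ℝ) * ((m / d₂ : ℕ) : ℝ) ≤ ((2 * N : ℕ) : ℝ) ^ 2 := by
    rw [sq]; exact mul_le_mul hα hβ (Nat.cast_nonneg _) (by positivity)
  have hr7 : ((r + 1 : ℕ) : ℝ) ≤ ((2 * N : ℕ) : ℝ) ^ 7 := by
    exact_mod_cast Nat.succ_le_of_lt (Finset.mem_range.mp hr)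
  have hc8 : ((q * (r + 1) : ℕ) : ℝ) ≤ ((2 * N : ℕ) : ℝ) ^ 8 := by
    have hr7' : (r : ℝ) + 1 ≤ (2 * (N : ℝ)) ^ 7 := by have := hr7; push_cast at this; exact this
    push_cast
    calc (q : ℝ) * ((r : ℝ) + 1) ≤ (2 * N) * ((2 * (N : ℝ)) ^ 7) :=
          mul_le_mul hqP hr7' (by positivity) (by positivity)
      _ = (2 * (N : ℝ)) ^ 8 := by ring
  have hden : (1 : ℝ) ≤ (q : ℝ) * ((r + 1 : ℕ) : ℝ) := by
    have : (1 : ℝ) ≤ ((r + 1 : ℕ) : ℝ) := by exact_mod_cast Nat.succ_pos r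
    exact one_le_mul_of_one_le_of_one_le hq1 this
  have hK₁' : (2 : ℝ) ^ i.1 ≤ ((2 * N : ℕ) : ℝ) ^ 5 := by push_cast at hK₁ ⊢; exact hK₁
  have hK₂' : (2 : ℝ) ^ i.2 ≤ ((2 * N : ℕ) : ℝ) ^ 5 := by push_cast at hK₂ ⊢; exact hK₂
  have hD := dTerm_le (K := (2 : ℝ) ^ i.2) (K' := (2 : ℝ) ^ i.1) hP1' (Nat.cast_nonneg _) (Nat.cast_nonneg _) hαβ
    (by positivity) hK₂' (one_le_pow₀ (by norm_num)) hK₁' hden hc8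
  have hQ : (q : ℝ) ^ ε₀ ≤ ((2 * N : ℕ) : ℝ) := by
    calc (q : ℝ) ^ ε₀ ≤ (q : ℝ) ^ (1 : ℝ) := Real.rpow_le_rpow_of_exponent_le hq1 hε₁
      _ = q := Real.rpow_one _
      _ ≤ ((2 * N : ℕ) : ℝ) := by push_cast; exact hqP
  rw [coreHeight_apply]
  have hx0 : 0 ≤ ((q * (r + 1) : ℕ) : ℝ) * ((1 + 4 * π * Real.sqrt (((l / d₁ : ℕ) : ℝ) * ((m / d₂ : ℕ) : ℝ) * (2 * 2 ^ i.2)) /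
      ((q : ℝ) * ((r + 1 : ℕ) : ℝ)) * Real.sqrt (2 * 2 ^ i.1)) / ((2 : ℝ) ^ i.1 / 2)) / (2 * π) * (q : ℝ) ^ ε₀ := by positivity
  have hmain : ((q * (r + 1) : ℕ) : ℝ) * ((1 + 4 * π * Real.sqrt (((l / d₁ : ℕ) : ℝ) * ((m / d₂ : ℕ) : ℝ) * (2 * 2 ^ i.2)) /
      ((q : ℝ) * ((r + 1 : ℕ) : ℝ)) * Real.sqrt (2 * 2 ^ i.1)) / ((2 : ℝ) ^ i.1 / 2)) / (2 * π) * (q : ℝ) ^ ε₀ ≤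
      11 * ((2 * N : ℕ) : ℝ) ^ 14 * ((2 * N : ℕ) : ℝ) :=
    mul_le_mul hD hQ (Real.rpow_nonneg (Nat.cast_nonneg _) _) (by positivity)
  refine (natCeil_le_add_one hx0 hmain).trans ?_
  push_cast
  have h15 : (1 : ℝ) ≤ (2 * (N : ℝ)) ^ 15 := one_le_pow₀ hP1
  nlinarith [h15]

/-- **`D₂(N)/(2π)` is a block monomial**: on the cell nest at `2N` (`2N ≥ 40`, `0 < Δ′ ≤ 2`, `N ≥ 1`):
`D₂(N; cell)/(2π) ≤ 11·(2N)^{14}`. [folklore] -/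
theorem dCostSnd_div_le_block (hN : 1 ≤ N) (hP : 40 ≤ 2 * N) {Δ' : ℝ} (h0 : 0 < Δ') (h2 : Δ' ≤ 2)
    {r l m d₁ d₂ : ℕ} {i : ℕ × ℕ} (hl : l ∈ Finset.Icc 1 ⌊qhat (2 * N) ^ Δ'⌋₊)
    (hm : m ∈ Finset.Icc 1 ⌊qhat (2 * N) ^ Δ'⌋₊) (hd₁ : d₁ ∈ l.divisors) (hd₂ : d₂ ∈ m.divisors)
    (hi : i ∈ nearBoxes (2 * N) d₁ d₂ (Real.log (2 * N : ℕ) ^ 4)) :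
    dCostSnd N (l / d₁) (m / d₂) (r + 1) i / (2 * π) ≤ 11 * (2 * (N : ℝ)) ^ 14 := by
  have hN1 : (1 : ℝ) ≤ N := by exact_mod_cast hN
  have hP1 : (1 : ℝ) ≤ ((2 * N : ℕ) : ℝ) := by push_cast; linarith
  have hd₁1 := Nat.pos_of_mem_divisors hd₁
  have hd₂1 := Nat.pos_of_mem_divisors hd₂
  obtain ⟨hK₁, hK₂⟩ := pow_le_block_of_mem_nearBoxes hP hd₁1 hd₂1 hi
  have hfl : (⌊qhat (2 * N) ^ Δ'⌋₊ : ℝ) ≤ ((2 * N : ℕ) : ℝ) := by exact_mod_cast floor_qhat_rpow_le_self hP h0 h2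
  have hα : (((l / d₁ : ℕ)) : ℝ) ≤ ((2 * N : ℕ) : ℝ) :=
    le_trans (by exact_mod_cast (Nat.div_le_self l d₁).trans (Finset.mem_Icc.mp hl).2) hfl
  have hβ : (((m / d₂ : ℕ)) : ℝ) ≤ ((2 * N : ℕ) : ℝ) :=
    le_trans (by exact_mod_cast (Nat.div_le_self m d₂).trans (Finset.mem_Icc.mp hm).2) hfl
  have hβα : ((m / d₂ : ℕ) : ℝ) * ((l / d₁ : ℕ) : ℝ) ≤ ((2 * N : ℕ) : ℝ) ^ 2 := by
    rw [sq]; exact mul_le_mul hβ hα (Nat.cast_nonneg _) (by positivity)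
  have hden : (1 : ℝ) ≤ (N : ℝ) * ((r + 1 : ℕ) : ℝ) := by
    have : (1 : ℝ) ≤ ((r + 1 : ℕ) : ℝ) := by exact_mod_cast Nat.succ_pos r
    exact one_le_mul_of_one_le_of_one_le hN1 this
  have hK₁' : (2 : ℝ) ^ i.1 ≤ ((2 * N : ℕ) : ℝ) ^ 5 := by push_cast at hK₁ ⊢; exact hK₁
  have hK₂' : (2 : ℝ) ^ i.2 ≤ ((2 * N : ℕ) : ℝ) ^ 5 := by push_cast at hK₂ ⊢; exact hK₂
  have hD := dTerm_le (K := (2 : ℝ) ^ i.1) (K' := (2 : ℝ) ^ i.2) (c := (1 : ℝ)) hP1 (Nat.cast_nonneg _)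
    (Nat.cast_nonneg _) hβα (by positivity) hK₁' (one_le_pow₀ (by norm_num)) hK₂' hden
    ((one_le_pow₀ hP1).trans (le_refl _))
  unfold dCostSnd
  rw [one_mul] at hD
  push_cast at hD ⊢
  exact hD

/-- **The tail height is a block monomial**: for `|h₁| ≤ 12(2N)^{15}` (the range of `coreHeight`), `0 ≤ ε₀ ≤ 1`:
`tailHeight − 1 ≤ 134·(2N)^{30}`. [folklore] -/
theorem tailHeight_sub_one_le_block (hN : 1 ≤ N) (hP : 40 ≤ 2 * N) {Δ' : ℝ} (h0 : 0 < Δ') (h2 : Δ' ≤ 2)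
    {ε₀ : ℝ} (hε₁ : ε₀ ≤ 1) {r l m d₁ d₂ : ℕ} {i : ℕ × ℕ}
    (hl : l ∈ Finset.Icc 1 ⌊qhat (2 * N) ^ Δ'⌋₊) (hm : m ∈ Finset.Icc 1 ⌊qhat (2 * N) ^ Δ'⌋₊)
    (hd₁ : d₁ ∈ l.divisors) (hd₂ : d₂ ∈ m.divisors) (hi : i ∈ nearBoxes (2 * N) d₁ d₂ (Real.log (2 * N : ℕ) ^ 4))
    {h₁ : ℤ} (hh : |(h₁ : ℝ)| ≤ 12 * (2 * (N : ℝ)) ^ 15) :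
    ((tailHeight ε₀ N r l m d₁ d₂ i h₁ - 1 : ℕ) : ℝ) ≤ 134 * (2 * (N : ℝ)) ^ 30 := by
  have hN1 : (1 : ℝ) ≤ N := by exact_mod_cast hN
  have hP1 : (1 : ℝ) ≤ 2 * (N : ℝ) := by linarith
  have hD := dCostSnd_div_le_block (r := r) hN hP h0 h2 hl hm hd₁ hd₂ hi
  have hD0 := dCostSnd_nonneg N (l / d₁) (m / d₂) (r + 1) i
  have hQ : (2 * (N : ℝ)) ^ ε₀ ≤ 2 * (N : ℝ) := by
    calc (2 * (N : ℝ)) ^ ε₀ ≤ (2 * (N : ℝ)) ^ (1 : ℝ) := Real.rpow_le_rpow_of_exponent_le hP1 hε₁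
      _ = 2 * (N : ℝ) := Real.rpow_one _
  have hx0 : 0 ≤ |(h₁ : ℝ)| * dCostSnd N (l / d₁) (m / d₂) (r + 1) i / (2 * π) * (2 * (N : ℝ)) ^ ε₀ := by positivity
  have hx : |(h₁ : ℝ)| * dCostSnd N (l / d₁) (m / d₂) (r + 1) i / (2 * π) * (2 * (N : ℝ)) ^ ε₀ ≤
      (12 * (2 * (N : ℝ)) ^ 15) * (11 * (2 * (N : ℝ)) ^ 14) * (2 * (N : ℝ)) := by
    rw [mul_div_assoc]
    exact mul_le_mul (mul_le_mul hh hD (by positivity) (by positivity)) hQ (by positivity) (by positivity)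
  have hceil := natCeil_le_add_one hx0 hx
  have hsub : (tailHeight ε₀ N r l m d₁ d₂ i h₁ - 1 : ℕ) =
      ⌈|(h₁ : ℝ)| * dCostSnd N (l / d₁) (m / d₂) (r + 1) i / (2 * π) * (2 * (N : ℝ)) ^ ε₀⌉₊ + 1 := by
    unfold tailHeight; omega
  rw [hsub]
  push_cast
  have h30 : (1 : ℝ) ≤ (2 * (N : ℝ)) ^ 30 := one_le_pow₀ hP1
  nlinarith [h30, hceil]

/-- **The box size `S₂(k)` is a block monomial**: `S₂(k; cell, q) ≤ 9·S_k·(2N)^{10}` on the near boxes at `2N` (`d_j ≥ 1`).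
[folklore] -/
theorem boxSizeSnd_le_block (hP : 40 ≤ 2 * N) {d₁ d₂ r : ℕ} (hd₁ : 1 ≤ d₁) (hd₂ : 1 ≤ d₂) {i : ℕ × ℕ}
    (hi : i ∈ nearBoxes (2 * N) d₁ d₂ (Real.log (2 * N : ℕ) ^ 4)) (k : ℕ) :
    (3 * 2 ^ i.1 / 2) * (3 * 2 ^ i.2 / 2) *
        (∑ j ∈ Finset.range (k + 1), (k.choose j : ℝ) * (2 ^ j * dyadicBumpBound j) *
          ((((k - j : ℕ) : ℝ) + 1) ^ 2 * (k - j) ! * ((k - j : ℕ) : ℝ) ^ (k - j))) *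
        (((d₂ : ℝ) * d₁ * (2 ^ i.1 / 2)) ^ (-(1 : ℝ) / 2) * ((r + 1 : ℕ) : ℝ)⁻¹ * ((2 : ℝ) ^ i.2 / 2) ^ (-(1 : ℝ) / 2)) ≤
      9 * (∑ j ∈ Finset.range (k + 1), (k.choose j : ℝ) * (2 ^ j * dyadicBumpBound j) *
          ((((k - j : ℕ) : ℝ) + 1) ^ 2 * (k - j) ! * ((k - j : ℕ) : ℝ) ^ (k - j))) * (2 * (N : ℝ)) ^ 10 := by
  obtain ⟨hK₁, hK₂⟩ := pow_le_block_of_mem_nearBoxes hP hd₁ hd₂ hi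
  push_cast at hK₁ hK₂
  have hS0 : 0 ≤ ∑ j ∈ Finset.range (k + 1), (k.choose j : ℝ) * (2 ^ j * dyadicBumpBound j) *
      ((((k - j : ℕ) : ℝ) + 1) ^ 2 * (k - j) ! * ((k - j : ℕ) : ℝ) ^ (k - j)) :=
    Finset.sum_nonneg fun j _ ↦ by have := dyadicBumpBound_nonneg j; positivity
  have hE : ((d₂ : ℝ) * d₁ * (2 ^ i.1 / 2)) ^ (-(1 : ℝ) / 2) * ((r + 1 : ℕ) : ℝ)⁻¹ * ((2 : ℝ) ^ i.2 / 2) ^ (-(1 : ℝ) / 2) ≤ 4 :=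
    sizeFactor_le_four (by exact_mod_cast hd₂) (by exact_mod_cast hd₁) (one_le_pow₀ (by norm_num))
      (one_le_pow₀ (by norm_num)) (by exact_mod_cast Nat.succ_pos r)
  have hE0 : 0 ≤ ((d₂ : ℝ) * d₁ * (2 ^ i.1 / 2)) ^ (-(1 : ℝ) / 2) * ((r + 1 : ℕ) : ℝ)⁻¹ * ((2 : ℝ) ^ i.2 / 2) ^ (-(1 : ℝ) / 2) := by
    have h1 : 0 ≤ ((d₂ : ℝ) * d₁ * (2 ^ i.1 / 2)) ^ (-(1 : ℝ) / 2) := Real.rpow_nonneg (by positivity) _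
    have h2 : 0 ≤ ((2 : ℝ) ^ i.2 / 2) ^ (-(1 : ℝ) / 2) := Real.rpow_nonneg (by positivity) _
    positivity
  have hP' : (3 * (2 : ℝ) ^ i.1 / 2) * (3 * 2 ^ i.2 / 2) ≤ 9 / 4 * (2 * (N : ℝ)) ^ 10 := by
    calc (3 * (2 : ℝ) ^ i.1 / 2) * (3 * 2 ^ i.2 / 2) = 9 / 4 * ((2 : ℝ) ^ i.1 * 2 ^ i.2) := by ring
      _ ≤ 9 / 4 * ((2 * (N : ℝ)) ^ 5 * (2 * (N : ℝ)) ^ 5) := by gcongr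
      _ = 9 / 4 * (2 * (N : ℝ)) ^ 10 := by ring
  calc _ ≤ (9 / 4 * (2 * (N : ℝ)) ^ 10) * (∑ j ∈ Finset.range (k + 1), (k.choose j : ℝ) * (2 ^ j * dyadicBumpBound j) *
          ((((k - j : ℕ) : ℝ) + 1) ^ 2 * (k - j) ! * ((k - j : ℕ) : ℝ) ^ (k - j))) * 4 :=
        mul_le_mul (mul_le_mul_of_nonneg_right hP' hS0) hE hE0 (by positivity)
    _ = _ := by ring

/-- **The scalar level factor is bounded by `4π`**: `‖𝟙[cell ∈ ranges q]·2q̂(2π/q)·c_l(q)c_m(q)‖ ≤ 4π` (`q ≥ 40`, `0 < Δ′`;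
`|c_l| ≤ 1` for the profile `X²`, `4πq̂/q ≤ 4π`). [cite: KowalskiMichelVanderKam2000, (9) p. 7 — derivation] -/
theorem norm_levelFactor_le (hq : 40 ≤ q) {Δ' : ℝ} (h0 : 0 < Δ') {r l m : ℕ} (hl1 : 1 ≤ l) (hm1 : 1 ≤ m)
    (d₁ d₂ : ℕ) (i : ℕ × ℕ)
    [Decidable (r < q ^ 7 ∧ l ≤ ⌊qhat q ^ Δ'⌋₊ ∧ m ≤ ⌊qhat q ^ Δ'⌋₊ ∧ i ∈ nearBoxes q d₁ d₂ (Real.log q ^ 4))] :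
    ‖(if r < q ^ 7 ∧ l ≤ ⌊qhat q ^ Δ'⌋₊ ∧ m ≤ ⌊qhat q ^ Δ'⌋₊ ∧ i ∈ nearBoxes q d₁ d₂ (Real.log q ^ 4) then
        2 * (qhat q : ℂ) * (2 * π / q) *
          (((mollifierCoeff (X ^ 2) (qhat q ^ Δ') l * mollifierCoeff (X ^ 2) (qhat q ^ Δ') m : ℝ) : ℂ))
      else 0)‖ ≤ 4 * π := by
  haveI : NeZero q := ⟨by omega⟩
  split_ifs with hcond
  swap
  · rw [norm_zero]; positivity
  obtain ⟨-, hl, hm, -⟩ := hcond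
  have hs1 : 1 < qhat q := one_lt_qhat hq
  have hq0 : (0 : ℝ) < q := by exact_mod_cast (show 0 < q by omega)
  have hM1 : 1 < qhat q ^ Δ' := Real.one_lt_rpow hs1 h0
  have hX : ∀ t ∈ Set.Icc (0 : ℝ) 1, |(X ^ 2 : ℝ[X]).eval t| ≤ 1 := by
    intro t ht
    rw [eval_pow, eval_X, abs_pow, abs_of_nonneg ht.1]
    exact pow_le_one₀ ht.1 ht.2
  have hcoef : ∀ n : ℕ, 1 ≤ n → n ≤ ⌊qhat q ^ Δ'⌋₊ → |mollifierCoeff (X ^ 2) (qhat q ^ Δ') n| ≤ 1 := by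
    intro n h1n hn
    have hmem : n ∈ Finset.Icc 1 ⌊qhat q ^ Δ'⌋₊ := Finset.mem_Icc.mpr ⟨h1n, hn⟩
    have h := KMV2000.abs_mollifierCoeff_le hX hM1 hmem
    rw [← KMV2000.mollifierCoeff] at h
    have hn1 : (1 : ℝ) ≤ n := by exact_mod_cast h1n
    calc _ ≤ 1 * (n : ℝ) ^ (-(1 / 2 : ℝ)) := h
      _ ≤ 1 * 1 := by gcongr; exact Real.rpow_le_one_of_one_le_of_nonpos hn1 (by norm_num)
      _ = 1 := one_mul _
  have hcc : |mollifierCoeff (X ^ 2) (qhat q ^ Δ') l * mollifierCoeff (X ^ 2) (qhat q ^ Δ') m| ≤ 1 := by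
    rw [abs_mul]
    calc _ ≤ 1 * 1 := mul_le_mul (hcoef l hl1 hl) (hcoef m hm1 hm) (abs_nonneg _) zero_le_one
      _ = 1 := one_mul _
  have hpre : 4 * π * qhat q / q ≤ 4 * π := by
    rw [div_le_iff₀ hq0]
    have hsq : qhat q ^ 2 ≤ (q : ℝ) := qhat_sq_le q
    have : qhat q ≤ (q : ℝ) := le_trans (by nlinarith) hsq
    nlinarith [Real.pi_pos]
  rw [norm_mul, norm_prefactor, Complex.norm_real, Real.norm_eq_abs]
  calc 4 * π * qhat q / q * |mollifierCoeff (X ^ 2) (qhat q ^ Δ') l * mollifierCoeff (X ^ 2) (qhat q ^ Δ') m|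
      ≤ 4 * π * 1 := mul_le_mul hpre hcc (abs_nonneg _) (by positivity)
    _ = 4 * π := mul_one _

end Block

end Summit.Parity.GeneralizedHardyLittlewood.Theorems.BeyondDiagonalBeatsQuarter.OffDiag
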